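/-
Copyright (c) 2026 the pub-hodgecm-mathlib formalisation cell (harness21).  Prover seat hodgecm-mathlib-R90-C10-p08 (g0), HCML SLAB R90-TF, section S1
«Ch10-local» (planner `R90-C10-plan`, EMIT S1 WAVE 1 2026-09-04T15:32:01Z), socket S1#2 `R90.S1.stub_R90_122_bz_twoConstituents` (second hand, road β′
«UNITARY COMPLETE REDUCIBILITY + FROBENIUS MULTIPLICITY ONE»), file U of three.  2026-09-04.
-/
import Literature.NumberTheory.Automorphic.UnitaryGroupPrincipalSeriesExponents           -- ★ `cmTorusCharPair`, `cmWeylTorusCharPair`, `weylTorusCharPair`, `conjInvChar`, `torusCharPair`, `normOneUnits`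
import Literature.NumberTheory.Automorphic.UnitaryEllipticCentralizerCompactNonsplit       -- ★ `isCompact_setOf_conjLocal_mul_self_eq_one` (`L_w¹` compact at a non-split `v`); brings ★ `continuous_conjLocal`
import HarnessLib

/-!
# R90 · S1 — a `w`-FIXED character `χ = wχ` of the diagonal torus of `U(Φ₃)(L⁺_v)` (non-split `v`) is UNITARY

Cell `pub/hodgecm-mathlib`, crux H413 = `stmt-HodgeConjecture-24833`; `--supports stmt-HodgeConjecture-24833 --as helper`; THEOREMS ONLY (no definition ∕
instance ∕ notation ∕ named fact ∕ `sorry`); never imports `Cruxes/…/Lines`.  COUNT-NEUTRAL.  File U of the three-file payment of socket S1#2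
`Summit.HodgeConjecture.HodgeConjecture.R90.S1.stub_R90_122_bz_twoConstituents` ([Rogawski1990, §12.2 p. 173] «if `i_G(χ)` is reducible, it contains exactly
two irreducible constituents ([BZ])»): the input of the SELF-DUAL case `wχ = χ` (⊇ Keys' case (3), the l.d.s. packets `Π(θ)`), where the two Jacquet
exponents coincide and only unitarity of `i_G(χ)` separates the two constituents.

THE MATHEMATICS ([Rogawski1990, §12.1 p. 171, §12.2 p. 173]; [Keys1984, §7]; [Casselman1995, §3.1]).  `χ = (χ₁, χ₂)`, `χ(d(α, β, ᾱ⁻¹)) = χ₁(α) χ₂(αᾱ⁻¹β)`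
(★ `torusCharPair`), `wχ = (χ̄₁⁻¹, χ₂)` (★ `weylTorusCharPair`).  On the section `α ↦ d(α, ᾱα⁻¹, ᾱ⁻¹)` the pair is `χ₁(α)` and its Weyl conjugate is
`χ₁(ᾱ)⁻¹`, so `wχ = χ` forces `χ₁(α) χ₁(ᾱ) = 1`, i.e. `χ₁(α)² = χ₁(α ᾱ⁻¹)` with `α ᾱ⁻¹ ∈ E¹` (★ `quotConj`).  At a NON-SPLIT `v` the group `E¹_v`
is COMPACT (★ `isCompact_setOf_conjLocal_mul_self_eq_one`, transported to the unit group along `Units.embedProduct`: on `E¹` the inverse is `σ`), and a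
continuous character of a compact group is unitary; hence `‖χ₁‖ = 1` on `E_v^×`, `‖χ₂‖ = 1` on `E¹_v`, and `‖χ(t)‖ = ‖χ₁(t₀₀)‖ ‖χ₂(det t)‖ = 1`.
* §1 (generic `R`, involution `σ`, `J = Φ₃`, `E¹` compact; private) `norm_torusCharPair_eq_one_of_weylTorusCharPair_eq`;
* §2 (CM; private `compactSpace_normOneUnits_conjLocal_of_nonsplit`, then the ONE public theorem) **`norm_cmTorusCharPair_eq_one_of_cmWeylTorusCharPair_eq`** — at a non-split `v`, for continuous `χ₁`, `χ₂` with
  `cmWeylTorusCharPair L v χ₁ χ₂ = cmTorusCharPair L v χ₁ χ₂`: `‖cmTorusCharPair L v χ₁ χ₂ t‖ = 1` for every `t`.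
HONEST LABEL: HC_CM is proved only modulo the 7 printed citations (2 remaining named inputs: hLiu418 = stmt-HodgeConjecture-24832, h413 = stmt-HodgeConjecture-24833)
until rung 0 closes; count-neutral helper.

## Tree search
★ `torusCharPair_apply(_of_glDiagonal_eq)`, `weylTorusCharPair_eq`, `conjInvChar_apply`, `mem_normOneUnits_iff`, `quotConj`, `coe_quotConj`,
`glDiagonal_mem_unitaryGroupOfForm_antidiagonal_iff`, `torusDet_eq_of_glDiagonal_eq`, `isCompact_setOf_conjLocal_mul_self_eq_one`, `continuous_conjLocal`,
`conjLocal_conjLocal_cm`; Mathlib `Units.isEmbedding_embedProduct`, `isCompact_range`, `pow_unbounded_of_one_lt`.  Dedup: `rg "norm_torusCharPair_eq_one|norm_cmTorusCharPair_eq_one"` — no hits.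

## References
* [Rogawski1990] J. D. Rogawski, *Automorphic Representations of Unitary Groups in Three Variables*, Ann. of Math. Stud. 123 (1990), §12.1 p. 171, §12.2 p. 173.
* [Keys1984] D. Keys, *Principal series representations of special unitary groups over local fields*, Compositio Math. 51 (1984), §7.
* [Casselman1995] W. Casselman, *Introduction to the theory of admissible representations of p-adic reductive groups* (1995), §3.1.
* [PlatonovRapinchuk1994] V. Platonov, A. Rapinchuk, *Algebraic Groups and Number Theory* (1994), §3.3 (compact tori over local fields).
-/

set_option autoImplicit false
set_option linter.dupNamespace false

noncomputable section

open NumberField IsDedekindDomain Topology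
open scoped Matrix MatrixGroups

namespace Summit.HodgeConjecture.HodgeConjecture.R90.S1

open Literature.NumberTheory Literature.NumberTheory.Automorphic Literature.NumberTheory.Automorphic.UnitaryGroup

/-! ## §0 A continuous character of a compact group is unitary -/

/-- A group homomorphism `χ : Z →* ℂˣ` on a compact topological group, continuous as a map to `ℂ`, takes values of norm `1` (the image of `‖χ‖` is a
bounded subgroup of `ℝ_{>0}`); the bare-`MonoidHom` form of ★ `ContinuousMonoidHom.norm_apply_eq_one`. [folklore] -/
private theorem norm_apply_eq_one_of_compactSpace {Z : Type*} [Group Z] [TopologicalSpace Z] [CompactSpace Z]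
    (χ : Z →* ℂˣ) (hχ : Continuous fun z => ((χ z : ℂˣ) : ℂ)) (z : Z) : ‖((χ z : ℂˣ) : ℂ)‖ = 1 := by
  obtain ⟨M, hM⟩ : ∃ M : ℝ, ∀ t : Z, ‖((χ t : ℂˣ) : ℂ)‖ ≤ M := by
    obtain ⟨M, hM⟩ := (isCompact_range hχ.norm).isBounded.bddAbove
    exact ⟨M, fun t => hM ⟨t, rfl⟩⟩
  have hle : ∀ t : Z, ‖((χ t : ℂˣ) : ℂ)‖ ≤ 1 := fun t => not_lt.mp fun hlt => by
    obtain ⟨n, hn⟩ := pow_unbounded_of_one_lt M hlt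
    have h := hM (t ^ n)
    rw [map_pow, Units.val_pow_eq_pow_val, norm_pow] at h
    exact (lt_irrefl M) (hn.trans_le h)
  refine le_antisymm (hle z) ?_
  have hinv := hle z⁻¹
  rw [map_inv, Units.val_inv_eq_inv_val, norm_inv] at hinv
  have hpos : 0 < ‖((χ z : ℂˣ) : ℂ)‖ := norm_pos_iff.2 (Units.ne_zero _)
  exact (inv_le_one₀ hpos).1 hinv

/-! ## §1 Generic: `R`, a continuous involution `σ`, `J = Φ₃`, `E¹ = normOneUnits σ` compact -/

section Generic

variable {R : Type*} [CommRing R] [TopologicalSpace R] (σ : R →+* R)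

omit [TopologicalSpace R] in
/-- **`wχ = χ` on the torus of `U(σ, Φ₃)(R)` forces `χ₁(α) · χ₁(σ α) = 1`** for every unit `α` — evaluate both sides at the section
`d(α, ᾱα⁻¹, ᾱ⁻¹) ∈ T` (★ `torusCharPair_apply_of_glDiagonal_eq`: there `χ = χ₁(α)`, `wχ = χ₁(ᾱ)⁻¹`). [cite: Rogawski1990, §12.1 p. 171, §12.2 p. 173] -/
private theorem apply_mul_apply_map_eq_one_of_weylTorusCharPair_eq (hσ : ∀ x : R, σ (σ x) = x) (J₃ : Matrix (Fin 3) (Fin 3) R)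
    (hJ : J₃ = (StdForm.antidiagonal 3).over R) (χ₁ : Rˣ →* ℂˣ) (χ₂ : ↥(normOneUnits σ) →* ℂˣ)
    (hw : weylTorusCharPair σ J₃ hJ 0 χ₁ χ₂ = torusCharPair σ J₃ hJ 0 χ₁ χ₂) (α : Rˣ) :
    χ₁ α * χ₁ (Units.map (σ : R →* R) α) = 1 := by
  subst hJ
  have hσu : ∀ u : Rˣ, Units.map (σ : R →* R) (Units.map (σ : R →* R) u) = u := fun u => Units.ext (hσ u)
  have hσv : ∀ u : Rˣ, σ (u : R) = ((Units.map (σ : R →* R) u : Rˣ) : R) := fun u => rfl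
  -- the section `α ↦ d(α, ᾱα⁻¹, ᾱ⁻¹)`
  let d₁ : Fin 3 → Rˣ := ![α, Units.map (σ : R →* R) α * α⁻¹, (Units.map (σ : R →* R) α)⁻¹]
  have hd₁ : glDiagonal 3 R d₁ ∈ unitaryGroupOfForm σ ((StdForm.antidiagonal 3).over R) := by
    rw [glDiagonal_mem_unitaryGroupOfForm_antidiagonal_iff]
    intro i
    fin_cases i
    · show σ (((Units.map (σ : R →* R) α)⁻¹ : Rˣ) : R) * (α : R) = 1
      rw [hσv, map_inv, hσu, Units.inv_mul]
    · show σ ((Units.map (σ : R →* R) α * α⁻¹ : Rˣ) : R) * ((Units.map (σ : R →* R) α * α⁻¹ : Rˣ) : R) = 1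
      rw [hσv, map_mul, map_inv, hσu, ← Units.val_mul, mul_assoc, inv_mul_cancel_left, mul_inv_cancel, Units.val_one]
    · show σ ((α : Rˣ) : R) * (((Units.map (σ : R →* R) α)⁻¹ : Rˣ) : R) = 1
      rw [hσv, Units.mul_inv]
  let t₁ : ↥(torusU σ ((StdForm.antidiagonal 3).over R)) := ⟨⟨glDiagonal 3 R d₁, hd₁⟩, ⟨d₁, rfl⟩⟩
  have hprod : (⟨∏ j, d₁ j, by
      rw [← torusDet_eq_of_glDiagonal_eq σ _ t₁ d₁ rfl]; exact torusDet_mem_normOneUnits σ _ rfl t₁⟩ : ↥(normOneUnits σ)) = 1 := by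
    apply Subtype.ext
    show ∏ j, d₁ j = 1
    rw [Fin.prod_univ_three]
    show α * (Units.map (σ : R →* R) α * α⁻¹) * (Units.map (σ : R →* R) α)⁻¹ = 1
    rw [mul_comm (Units.map (σ : R →* R) α) α⁻¹, ← mul_assoc, mul_inv_cancel, one_mul, mul_inv_cancel]
  have hχt₁ : ∀ χ : Rˣ →* ℂˣ, torusCharPair σ _ rfl 0 χ χ₂ t₁ = χ α := by
    intro χ
    rw [torusCharPair_apply_of_glDiagonal_eq σ _ rfl 0 χ χ₂ t₁ d₁ rfl, hprod, map_one, mul_one]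
    rfl
  have h := DFunLike.congr_fun hw t₁
  rw [weylTorusCharPair_eq, hχt₁, hχt₁, conjInvChar_apply] at h
  rw [← h, inv_mul_cancel]

/-- **A `w`-fixed pair character of the torus of `U(σ, Φ₃)(R)` is unitary when `E¹ = {x : σ(x) x = 1}` is compact** (`σ` a continuous involution,
`χ₁`, `χ₂` continuous): `‖χ(t)‖ = ‖χ₁(t₀₀)‖ · ‖χ₂(det t)‖ = 1`, since `‖χ₂‖ = 1` and `‖χ₁|_{E¹}‖ = 1` (compact group) and
`χ₁(α)² = χ₁(α) χ₁(σ α)⁻¹ = χ₁(α σ(α)⁻¹)` with `α σ(α)⁻¹ ∈ E¹` (★ `quotConj`). [cite: Rogawski1990, §12.2 p. 173] [cite: Keys1984, §7] -/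
private theorem norm_torusCharPair_eq_one_of_weylTorusCharPair_eq (hσ : ∀ x : R, σ (σ x) = x) (J₃ : Matrix (Fin 3) (Fin 3) R)
    (hJ : J₃ = (StdForm.antidiagonal 3).over R) (hE : CompactSpace ↥(normOneUnits σ))
    (χ₁ : Rˣ →* ℂˣ) (χ₂ : ↥(normOneUnits σ) →* ℂˣ)
    (h1c : Continuous fun x => ((χ₁ x : ℂˣ) : ℂ)) (h2c : Continuous fun x => ((χ₂ x : ℂˣ) : ℂ))
    (hw : weylTorusCharPair σ J₃ hJ 0 χ₁ χ₂ = torusCharPair σ J₃ hJ 0 χ₁ χ₂) (t : ↥(torusU σ J₃)) :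
    ‖((torusCharPair σ J₃ hJ 0 χ₁ χ₂ t : ℂˣ) : ℂ)‖ = 1 := by
  -- `‖χ₂‖ = 1` on the compact `E¹`, and `‖χ₁|_{E¹}‖ = 1`
  have h2 : ∀ u : ↥(normOneUnits σ), ‖((χ₂ u : ℂˣ) : ℂ)‖ = 1 := norm_apply_eq_one_of_compactSpace χ₂ h2c
  have h1E : ∀ u : ↥(normOneUnits σ), ‖((χ₁ (u : Rˣ) : ℂˣ) : ℂ)‖ = 1 :=
    norm_apply_eq_one_of_compactSpace (χ₁.comp (normOneUnits σ).subtype) (h1c.comp continuous_subtype_val)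
  -- `‖χ₁(α)‖² = ‖χ₁(α σ(α)⁻¹)‖ = 1`
  have h1 : ∀ α : Rˣ, ‖((χ₁ α : ℂˣ) : ℂ)‖ = 1 := by
    intro α
    have hrel := apply_mul_apply_map_eq_one_of_weylTorusCharPair_eq σ hσ J₃ hJ χ₁ χ₂ hw α
    have hq : χ₁ (quotConj σ hσ α : Rˣ) = χ₁ α * χ₁ α := by
      rw [coe_quotConj, map_mul, map_inv, ← eq_inv_of_mul_eq_one_left hrel]
    have hn := h1E (quotConj σ hσ α)
    rw [hq, Units.val_mul, norm_mul] at hn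
    have hpos : 0 ≤ ‖((χ₁ α : ℂˣ) : ℂ)‖ := norm_nonneg _
    nlinarith [hn, hpos]
  rw [torusCharPair_apply, Units.val_mul, norm_mul, h1, h2, one_mul]

end Generic

/-! ## §2 The CM instance: `U(Φ₃)(L⁺_v)` at a NON-SPLIT finite place `v` -/

section CM

variable (L : Type) [Field L] [NumberField L] [IsCMField L] (v : HeightOneSpectrum (𝓞 ↥(maximalRealSubfield L)))

/-- **`E¹_v = {x ∈ (∏_{w ∣ v} L_w)ˣ : x̄ x = 1}` is compact at a non-split `v`** (as a subgroup of the unit group with its unit topology): under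
`Units.embedProduct` it is the image `x ↦ (x, x̄)` of the compact `{x : x̄ x = 1} ⊆ ∏_w L_w` (★ `isCompact_setOf_conjLocal_mul_self_eq_one`), the
inverse on `E¹` being `σ`. [cite: PlatonovRapinchuk1994, §3.3] -/
private theorem compactSpace_normOneUnits_conjLocal_of_nonsplit (hns : ∀ w : PlacesOver L v, IsCMField.complexConj L • w.1 = w.1) :
    CompactSpace ↥(normOneUnits (conjLocal L (IsCMField.complexConj L) v)) := by
  obtain ⟨w⟩ : Nonempty (PlacesOver L v) := inferInstance
  set σv := conjLocal L (IsCMField.complexConj L) v with hσv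
  have hS := isCompact_setOf_conjLocal_mul_self_eq_one L w (hns w)
  -- the image of `E¹` under `embedProduct` is the image of `{x : σ x * x = 1}` under `x ↦ (x, op (σ x))`
  have himage : Units.embedProduct (LocalRing L v) '' (normOneUnits σv : Set (LocalRing L v)ˣ) =
      (fun x : LocalRing L v => (x, MulOpposite.op (σv x))) '' {x : LocalRing L v | σv x * x = 1} := by
    ext p
    constructor
    · rintro ⟨u, hu, rfl⟩
      have hu' : σv (u : LocalRing L v) * (u : LocalRing L v) = 1 := (mem_normOneUnits_iff u).1 hu
      refine ⟨(u : LocalRing L v), hu', ?_⟩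
      have hinv : ((u⁻¹ : (LocalRing L v)ˣ) : LocalRing L v) = σv (u : LocalRing L v) := Units.inv_eq_of_mul_eq_one_left hu'
      simp only [Units.embedProduct_apply, hinv]
    · rintro ⟨x, hx, rfl⟩
      have hx' : x * σv x = 1 := by rw [mul_comm]; exact hx
      refine ⟨⟨x, σv x, hx', hx⟩, (mem_normOneUnits_iff _).2 hx, ?_⟩
      simp only [Units.embedProduct_apply]
      rfl
  have hc : IsCompact (normOneUnits σv : Set (LocalRing L v)ˣ) := by
    rw [Units.isEmbedding_embedProduct.isCompact_iff, himage]
    exact hS.image ((continuous_id.prodMk (MulOpposite.continuous_op.comp (continuous_conjLocal L (IsCMField.complexConj L) v))))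
  exact isCompact_iff_compactSpace.1 hc

/-- **A `w`-FIXED CHARACTER OF THE TORUS OF `U(Φ₃)(L⁺_v)` IS UNITARY, `v` NON-SPLIT**: for continuous `χ₁`, `χ₂` with
`wχ = χ` (★ `cmWeylTorusCharPair L v χ₁ χ₂ = cmTorusCharPair L v χ₁ χ₂`, i.e. `χ₁(α) χ₁(ᾱ) = 1` — the self-dual point containing Keys' case (3)
«`χ₁` non-trivial, `χ₁|F* = 1`» and the unitary principal series `i_B(θ̃)` of the l.d.s. packets `Π(θ)`), `‖χ(t)‖ = 1` for every `t ∈ T(L⁺_v)` (§1 at the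
compact `E¹_v`, §2).  So `i_G(χ)` is unitarily induced. [cite: Rogawski1990, §12.2 (3) p. 173] [cite: Keys1984, §7] [cite: Casselman1995, §3.1] -/
theorem norm_cmTorusCharPair_eq_one_of_cmWeylTorusCharPair_eq (hns : ∀ w : PlacesOver L v, IsCMField.complexConj L • w.1 = w.1)
    (χ₁ : (LocalRing L v)ˣ →* ℂˣ) (χ₂ : ↥(normOneUnits (conjLocal L (IsCMField.complexConj L) v)) →* ℂˣ)
    (h1c : Continuous fun x => ((χ₁ x : ℂˣ) : ℂ)) (h2c : Continuous fun x => ((χ₂ x : ℂˣ) : ℂ))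
    (hw : cmWeylTorusCharPair L v χ₁ χ₂ = cmTorusCharPair L v χ₁ χ₂)
    (t : ↥(torusU (conjLocal L (IsCMField.complexConj L) v) (cmLocalForm L 3 v))) :
    ‖((cmTorusCharPair L v χ₁ χ₂ t : ℂˣ) : ℂ)‖ = 1 :=
  norm_torusCharPair_eq_one_of_weylTorusCharPair_eq (conjLocal L (IsCMField.complexConj L) v) (conjLocal_conjLocal_cm L v)
    (cmLocalForm L 3 v) (cmLocalForm_eq_over L 3 v) (compactSpace_normOneUnits_conjLocal_of_nonsplit L v hns) χ₁ χ₂ h1c h2c hw t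

end CM

end Summit.HodgeConjecture.HodgeConjecture.R90.S1

end
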